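import Mathlib
import HarnessLib

/-!
# Homogeneous values of the Ikhlef–Ponsaing symplectic characters: the `A_V` / `N_8` products

Topic `Literature/Combinatorics/Enumerative` (serves the named fact
`Literature.Probability.Percolation.IkhlefPonsaingFirstPassage`, Ikhlef–Ponsaing, J. Stat. Phys.
149 (2012) 10–36 = arXiv:1202.5476, Prop. 4.7).

Sources, read from the held text (`paper:arxiv-1202.5476`, pp. 7, 10). IP12 **Definition 3.4**: the
symplectic character `χ_λ^{(L)}(u_1,…,u_L) = det[u_i^{μ_j} - u_i^{-μ_j}] / det[u_i^{δ_j} - u_i^{-δ_j}]`,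
`δ_j = L - j + 1`, `μ_j = λ_j + δ_j`, restricted throughout to `λ_j = ⌊(L-j)/2⌋` (`χ_L := χ_λ^{(L)}`).
IP12 **Proposition 4.7** and its proof: "`P_b^{(L)} = A_V(L) A_V(L+2) / N_8(L+1)²` …
`A_V(2m+1) = ∏_{i=0}^{m-1} (3i+2)(6i+3)!(2i+1)!/((4i+2)!(4i+3)!)`,
`N_8(2m) = ∏_{i=0}^{m-1} (3i+1)(6i)!(2i)!/((4i)!(4i+1)!)` … The result is simply obtained from
(P1form) [`P_b^{(L)} = χ_{L-1} χ_{L+1} / χ_L²`, Prop. 4.5] and the homogeneous limit of the symplectic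
characters [DF07], `χ_{2m}(1,…,1) = 3^{m(m-1)} A_V(2m+1)`, `χ_{2m-1}(1,…,1) = 3^{(m-1)²} N_8(2m)`."

What this file does. `χ_λ^{(L)}` is Weyl's character of the irreducible `Sp(2L)`-module of highest
weight `λ` (`ρ = δ = (L, L-1, …, 1)`), so its value at the identity `u = (1,…,1)` is the Weyl
dimension (Fulton–Harris, (24.19))
`dim V_λ = ∏_{i<j} (μ_i² - μ_j²)/(δ_i² - δ_j²) · ∏_i μ_i/δ_i`.
Re-indexing from the far end (`k = L - j`, so `δ = k + 1`, `μ = k + 1 + ⌊k/2⌋ =: ipMu k`, the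
`(k+1)`-st positive integer prime to `3`, INDEPENDENT of `L`) this product is `ipSpDim L` below, and we
PROVE Di Francesco's two evaluations for it, in closed form and for every `m`:

* `ipSpDim_two_mul` : `ipSpDim (2m) = 3^{m(m-1)} · ipAV m` (`ipAV m = A_V(2m+1)` as printed),
* `ipSpDim_two_mul_add_one` : `ipSpDim (2m+1) = 3^{m²} · ipN8 (m+1)` (`ipN8 m = N_8(2m)` as printed),
* `ipSpDim_ratio`, `ipSpDim_ratio_real` : `ipSpDim(2m) ipSpDim(2m+2) / ipSpDim(2m+1)² =
  A_V(2m+1) A_V(2m+3) / N_8(2m+2)²` — exactly the arithmetic of the proof of Prop. 4.7 (the powers of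
  `3` cancel), the right-hand side written literally as in the named fact.

Proof (elementary, by induction on `L` two steps at a time). Adding the row `k = L` multiplies the
Weyl product by `ipSpStep L = μ_L/(L+1) · ∏_{k<L} (μ_L² - μ_k²)/((L+1)² - (k+1)²)`; the denominator row is
`(L+1) ∏_{k<L} ((L+1)² - (k+1)²) = (2L+1)!` (`ipDen`); the numerator rows factor, after pairing
`μ_{2t} = 3t+1`, `μ_{2t+1} = 3t+2` and re-indexing, into `Q(2m) = ∏_{s<2m} (3s+2)(3s+3)` (`L = 2m`,
`μ_L = 3m+1`; `ipNum_even`) and `(6m+3) R(2m)`, `R(n) = ∏_{s<n} (3s+3)(3s+4)` (`L = 2m+1`, `μ_L = 3m+2`;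
`ipNum_odd`); and `Q(n) R(n) = 3ⁿ n! (3n+1)!` (`prodQ_mul_prodR`). Hence
`ipSpStep(2m) ipSpStep(2m+1) = 3^{2m} a_m` and `ipSpStep(2m+1) ipSpStep(2m+2) = 3^{2m+1} n_{m+1}` with
`a_i`, `n_i` the factors of `A_V`, `N_8` (`ipSpStep_even_mul_odd`, `ipSpStep_odd_mul_even`), and the
closed forms follow (`m(m-1) + 2m = (m+1)m`, `m² + 2m + 1 = (m+1)²`).

What is NOT here. (i) The identification `χ_L(1,…,1) = ipSpDim L` (Weyl's character/dimension
formula for `Sp(2L)`, or the `u → 1` limit of the bialternant) — Mathlib has no Weyl character formula;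
`ipSpDim` is DEFINED as the dimension product. (ii) The combinatorial meaning of `A_V`, `N_8`
(Kuperberg; Razumov–Stroganov–type sum rules) and their integrality. (iii) Props. 3.4/4.5 of IP12 (the
`q`KZ computation) and the percolation dictionary — the named fact itself stays undischarged for `m ≥ 1`.

## References

* Y. Ikhlef, A. K. Ponsaing, *Finite-size left-passage probability in percolation*, J. Stat. Phys.
  149 (2012) 10–36, arXiv:1202.5476, Def. 3.4, Props. 4.5, 4.7. [IkhlefPonsaing2012]
* P. Di Francesco, *Open boundary quantum Knizhnik–Zamolodchikov equation and the weighted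
  enumeration of plane partitions with symmetries*, J. Stat. Mech. (2007) P01024,
  arXiv:math-ph/0611012 (the `[DF07]` of IP12). [DiFrancesco2007]
* W. Fulton, J. Harris, *Representation Theory*, GTM 129 (1991), §24.2, (24.19) (Weyl dimension
  formula for `sp_{2n}`). [FultonHarris1991]
-/

namespace Literature.Combinatorics.Enumerative

open Finset
open scoped BigOperators Nat

/-- The shifted exponents `μ` of the symplectic character `χ_L = χ_λ^{(L)}`, `λ_j = ⌊(L-j)/2⌋`,
`δ_j = L - j + 1`, `μ_j = λ_j + δ_j` (Ikhlef–Ponsaing 2012, Def. 3.4), re-indexed from the other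
end and from `0`: with `k = L - j` (`0 ≤ k < L`), `δ = k + 1` and `μ = k + 1 + ⌊k/2⌋`, i.e.
`ipMu k = 1, 2, 4, 5, 7, 8, …` — the positive integers prime to `3`, independent of `L`.
[cite: IkhlefPonsaing2012, Def. 3.4] -/
def ipMu (k : ℕ) : ℕ := k + 1 + k / 2

/-- `μ` at even index: `ipMu (2t) = 3t + 1`. [cite: IkhlefPonsaing2012, Def. 3.4] -/
@[simp] theorem ipMu_two_mul (t : ℕ) : ipMu (2 * t) = 3 * t + 1 := by
  unfold ipMu; omega

/-- `μ` at odd index: `ipMu (2t+1) = 3t + 2`. [cite: IkhlefPonsaing2012, Def. 3.4] -/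
@[simp] theorem ipMu_two_mul_add_one (t : ℕ) : ipMu (2 * t + 1) = 3 * t + 2 := by
  unfold ipMu; omega

/-- The one-step Weyl factor: passing from `Sp(2L)` to `Sp(2L+2)` multiplies the dimension by
`μ_L/(L+1) · ∏_{k<L} (μ_L² - μ_k²)/((L+1)² - (k+1)²)` (the new row/column of the Weyl product).
[cite: IkhlefPonsaing2012, Def. 3.4] -/
def ipSpStep (L : ℕ) : ℚ :=
  (ipMu L : ℚ) / ((L : ℚ) + 1) *
    ∏ k ∈ range L, (((ipMu L : ℚ)) ^ 2 - ((ipMu k : ℚ)) ^ 2) / ((((L : ℚ) + 1)) ^ 2 - (((k : ℚ) + 1)) ^ 2)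

/-- **The homogeneous symplectic character `χ_L(1,…,1)` as Weyl's dimension product.**
`ipSpDim L = ∏_{0 ≤ k < l < L} (μ_l² - μ_k²)/((l+1)² - (k+1)²) · ∏_{l < L} μ_l/(l+1)`, the Weyl
dimension formula of type `C_L` for the highest weight `λ_j = ⌊(L-j)/2⌋` (`ρ = δ = (L, …, 1)`),
i.e. the value at the identity `u = (1, …, 1)` of the symplectic character
`χ_λ^{(L)}(u) = det[u_i^{μ_j} - u_i^{-μ_j}] / det[u_i^{δ_j} - u_i^{-δ_j}]` of IP12 Def. 3.4 (the
identification "character at the identity = Weyl dimension", Fulton–Harris (24.19), is classical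
and NOT formalised here). Values: `1, 1, 1, 6, 27, 891, 18954, …` for `L = 0, 1, 2, 3, 4, 5, 6`.
[cite: IkhlefPonsaing2012, Def. 3.4 and Prop. 4.7 (proof)] -/
def ipSpDim (L : ℕ) : ℚ := ∏ l ∈ range L, ipSpStep l

/-- `A_V(2m+1) = ∏_{i<m} (3i+2)(6i+3)!(2i+1)!/((4i+2)!(4i+3)!)`, the number of vertically symmetric
alternating sign matrices of size `2m+1`, as printed in IP12 Prop. 4.7: `1, 1, 3, 26, 646, …`.
[cite: IkhlefPonsaing2012, Prop. 4.7] -/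
def ipAV (m : ℕ) : ℚ :=
  ∏ i ∈ range m, ((3 * i + 2 : ℕ) * (6 * i + 3)! * (2 * i + 1)! : ℚ) / ((4 * i + 2)! * (4 * i + 3)! : ℚ)

/-- `N_8(2m) = ∏_{i<m} (3i+1)(6i)!(2i)!/((4i)!(4i+1)!)`, the number of cyclically symmetric
self-complementary plane partitions in a `2m`-cube, as printed in IP12 Prop. 4.7: `1, 1, 2, 11, 170, …`.
[cite: IkhlefPonsaing2012, Prop. 4.7] -/
def ipN8 (m : ℕ) : ℚ :=
  ∏ i ∈ range m, ((3 * i + 1 : ℕ) * (6 * i)! * (2 * i)! : ℚ) / ((4 * i)! * (4 * i + 1)! : ℚ)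

/-! ### Product bookkeeping -/

/-- Pairing consecutive indices: `∏_{k<2m} f k = ∏_{t<m} f(2t) f(2t+1)`. [folklore] -/
theorem prod_range_two_mul {M : Type*} [CommMonoid M] (f : ℕ → M) (m : ℕ) :
    ∏ k ∈ range (2 * m), f k = ∏ t ∈ range m, (f (2 * t) * f (2 * t + 1)) := by
  induction m with
  | zero => simp
  | succ m ih =>
    rw [show 2 * (m + 1) = 2 * m + 1 + 1 by ring, prod_range_succ, prod_range_succ, ih,
      prod_range_succ, mul_assoc]

/-- The Weyl denominator row: `(L+1) ∏_{k<L} ((L+1)² - (k+1)²) = (2L+1)!`. [folklore] -/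
theorem ipDen (L : ℕ) :
    ((L : ℚ) + 1) * ∏ k ∈ range L, ((((L : ℚ) + 1)) ^ 2 - (((k : ℚ) + 1)) ^ 2) = ((2 * L + 1)! : ℚ) := by
  -- `(L+1)² - (k+1)² = (L - k)(L + k + 2)`; `∏ (L-k) = L!`, `(L+1)! ∏ (L+k+2) = (2L+1)!`.
  have h1 : ∏ k ∈ range L, ((((L : ℚ) + 1)) ^ 2 - (((k : ℚ) + 1)) ^ 2) =
      (∏ k ∈ range L, ((L - 1 - k : ℕ) + 1 : ℚ)) * ∏ k ∈ range L, ((L : ℚ) + k + 2) := by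
    rw [← prod_mul_distrib]
    refine prod_congr rfl fun k hk => ?_
    have hk' : k < L := mem_range.1 hk
    have : ((L - 1 - k : ℕ) : ℚ) = (L : ℚ) - 1 - k := by
      rw [Nat.sub_sub, Nat.cast_sub (by omega)]
      push_cast; ring
    rw [this]; ring
  have h2 : ∏ k ∈ range L, ((L - 1 - k : ℕ) + 1 : ℚ) = (L ! : ℚ) := by
    rw [prod_range_reflect (fun k => ((k : ℕ) + 1 : ℚ)) L]
    rw [← Finset.prod_range_add_one_eq_factorial]
    push_cast
    rfl
  have h3 : ((L + 1)! : ℚ) * ∏ k ∈ range L, ((L : ℚ) + k + 2) = ((2 * L + 1)! : ℚ) := by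
    have := Finset.prod_range_add (fun j => ((j : ℚ) + 1)) (L + 1) L
    rw [show L + 1 + L = 2 * L + 1 by ring] at this
    have e1 : ∏ x ∈ range (2 * L + 1), ((x : ℚ) + 1) = ((2 * L + 1)! : ℚ) := by
      rw [← Finset.prod_range_add_one_eq_factorial]; push_cast; rfl
    have e2 : ∏ x ∈ range (L + 1), ((x : ℚ) + 1) = ((L + 1)! : ℚ) := by
      rw [← Finset.prod_range_add_one_eq_factorial]; push_cast; rfl
    rw [e1, e2] at this
    rw [this]
    congr 1
    refine prod_congr rfl fun k _ => ?_
    push_cast; ring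
  rw [h1, h2, ← h3]
  push_cast [Nat.factorial_succ]
  ring


/-- `Q(n) R(n) = 3ⁿ n! (3n+1)!` for `Q(n) = ∏_{s<n} (3s+2)(3s+3)`, `R(n) = ∏_{s<n} (3s+3)(3s+4)`
(the two products together run over `2, 3, 3, 4, 5, 6, 6, 7, …`). [folklore] -/
theorem prodQ_mul_prodR (n : ℕ) :
    (∏ s ∈ range n, ((3 * s + 2) * (3 * s + 3))) * (∏ s ∈ range n, ((3 * s + 3) * (3 * s + 4))) =
      3 ^ n * n ! * (3 * n + 1)! := by
  induction n with
  | zero => simp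
  | succ n ih =>
    rw [prod_range_succ, prod_range_succ]
    have h : (3 * (n + 1) + 1)! = (3 * n + 4) * (3 * n + 3) * (3 * n + 2) * (3 * n + 1)! := by
      rw [show 3 * (n + 1) + 1 = (3 * n + 3) + 1 by ring, Nat.factorial_succ,
        show 3 * n + 3 = (3 * n + 2) + 1 by ring, Nat.factorial_succ,
        show 3 * n + 2 = (3 * n + 1) + 1 by ring, Nat.factorial_succ]
      ring
    rw [h, Nat.factorial_succ, pow_succ]
    calc (∏ s ∈ range n, ((3 * s + 2) * (3 * s + 3))) * ((3 * n + 2) * (3 * n + 3)) *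
          ((∏ s ∈ range n, ((3 * s + 3) * (3 * s + 4))) * ((3 * n + 3) * (3 * n + 4)))
        = (∏ s ∈ range n, ((3 * s + 2) * (3 * s + 3))) * (∏ s ∈ range n, ((3 * s + 3) * (3 * s + 4))) *
            ((3 * n + 2) * (3 * n + 3) * ((3 * n + 3) * (3 * n + 4))) := by ring
      _ = 3 ^ n * n ! * (3 * n + 1)! * ((3 * n + 2) * (3 * n + 3) * ((3 * n + 3) * (3 * n + 4))) := by
          rw [ih]
      _ = _ := by ring

/-- The same identity in `ℚ`. [folklore] -/
theorem prodQ_mul_prodR_cast (n : ℕ) :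
    (∏ s ∈ range n, ((3 * s + 2 : ℚ) * (3 * s + 3))) * (∏ s ∈ range n, ((3 * s + 3 : ℚ) * (3 * s + 4))) =
      (3 : ℚ) ^ n * (n ! : ℚ) * ((3 * n + 1)! : ℚ) := by
  have h := congrArg (Nat.cast : ℕ → ℚ) (prodQ_mul_prodR n)
  push_cast at h
  exact h

/-- **Even numerator row**: for `L = 2m` (new exponent `μ_L = 3m+1`),
`∏_{k<2m} (μ_L² - μ_k²) = ∏_{s<2m} (3s+2)(3s+3)` — pair `μ_{2t} = 3t+1`, `μ_{2t+1} = 3t+2`,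
factor the differences of squares and re-index (`s = m-1-t` and `s = m+t`).
[cite: IkhlefPonsaing2012, Prop. 4.7 (proof)] -/
theorem ipNum_even (m : ℕ) :
    ∏ k ∈ range (2 * m), ((((3 * m + 1 : ℕ) : ℚ)) ^ 2 - ((ipMu k : ℚ)) ^ 2) =
      ∏ s ∈ range (2 * m), ((3 * s + 2 : ℚ) * (3 * s + 3)) := by
  set G : ℕ → ℚ := fun s => (3 * s + 2 : ℚ) * (3 * s + 3) with hG
  have hg : ∀ t ∈ range m,
      ((((3 * m + 1 : ℕ) : ℚ)) ^ 2 - ((ipMu (2 * t) : ℚ)) ^ 2) *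
        ((((3 * m + 1 : ℕ) : ℚ)) ^ 2 - ((ipMu (2 * t + 1) : ℚ)) ^ 2) = G (m - 1 - t) * G (m + t) := by
    intro t ht
    have ht' : t < m := mem_range.1 ht
    have hc : ((m - 1 - t : ℕ) : ℚ) = (m : ℚ) - 1 - t := by
      rw [Nat.sub_sub, Nat.cast_sub (by omega)]
      push_cast
      ring
    simp only [hG, ipMu_two_mul, ipMu_two_mul_add_one]
    push_cast [hc]
    ring
  rw [prod_range_two_mul, prod_congr rfl hg, prod_mul_distrib, prod_range_reflect G m,
    ← prod_range_add G m m, ← two_mul]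

/-- **Odd numerator row**: for `L = 2m+1` (new exponent `μ_L = 3m+2`),
`∏_{k<2m+1} (μ_L² - μ_k²) = (6m+3) ∏_{s<2m} (3s+3)(3s+4)`. [cite: IkhlefPonsaing2012, Prop. 4.7 (proof)] -/
theorem ipNum_odd (m : ℕ) :
    ∏ k ∈ range (2 * m + 1), ((((3 * m + 2 : ℕ) : ℚ)) ^ 2 - ((ipMu k : ℚ)) ^ 2) =
      (6 * m + 3 : ℚ) * ∏ s ∈ range (2 * m), ((3 * s + 3 : ℚ) * (3 * s + 4)) := by
  set H : ℕ → ℚ := fun s => (3 * s + 3 : ℚ) * (3 * s + 4) with hH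
  have hh : ∀ t ∈ range m,
      ((((3 * m + 2 : ℕ) : ℚ)) ^ 2 - ((ipMu (2 * t) : ℚ)) ^ 2) *
        ((((3 * m + 2 : ℕ) : ℚ)) ^ 2 - ((ipMu (2 * t + 1) : ℚ)) ^ 2) = H (m - 1 - t) * H (m + t) := by
    intro t ht
    have ht' : t < m := mem_range.1 ht
    have hc : ((m - 1 - t : ℕ) : ℚ) = (m : ℚ) - 1 - t := by
      rw [Nat.sub_sub, Nat.cast_sub (by omega)]
      push_cast
      ring
    simp only [hH, ipMu_two_mul, ipMu_two_mul_add_one]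
    push_cast [hc]
    ring
  rw [prod_range_succ, prod_range_two_mul, prod_congr rfl hh, prod_mul_distrib, prod_range_reflect H m,
    ← prod_range_add H m m, ← two_mul, ipMu_two_mul]
  push_cast
  ring

/-- The one-step factor over the common denominator `(2L+1)!`:
`ipSpStep L = μ_L ∏_{k<L} (μ_L² - μ_k²) / (2L+1)!`. [cite: IkhlefPonsaing2012, Def. 3.4] -/
theorem ipSpStep_eq (L : ℕ) :
    ipSpStep L = (ipMu L : ℚ) * (∏ k ∈ range L, (((ipMu L : ℚ)) ^ 2 - ((ipMu k : ℚ)) ^ 2)) /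
      ((2 * L + 1)! : ℚ) := by
  unfold ipSpStep
  rw [prod_div_distrib, div_mul_div_comm, ipDen]

/-- **Even step**: `ipSpStep (2m) = (3m+1) Q(2m) / (4m+1)!`. [cite: IkhlefPonsaing2012, Prop. 4.7 (proof)] -/
theorem ipSpStep_two_mul (m : ℕ) :
    ipSpStep (2 * m) =
      (3 * m + 1 : ℚ) * (∏ s ∈ range (2 * m), ((3 * s + 2 : ℚ) * (3 * s + 3))) / ((4 * m + 1)! : ℚ) := by
  rw [ipSpStep_eq, ← ipNum_even, ipMu_two_mul, show 2 * (2 * m) + 1 = 4 * m + 1 by ring]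
  push_cast
  ring

/-- **Odd step**: `ipSpStep (2m+1) = (3m+2)(6m+3) R(2m) / (4m+3)!`. [cite: IkhlefPonsaing2012, Prop. 4.7 (proof)] -/
theorem ipSpStep_two_mul_add_one (m : ℕ) :
    ipSpStep (2 * m + 1) =
      (3 * m + 2 : ℚ) * ((6 * m + 3 : ℚ) * ∏ s ∈ range (2 * m), ((3 * s + 3 : ℚ) * (3 * s + 4))) /
        ((4 * m + 3)! : ℚ) := by
  rw [ipSpStep_eq, ← ipNum_odd, ipMu_two_mul_add_one, show 2 * (2 * m + 1) + 1 = 4 * m + 3 by ring]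
  push_cast
  ring

/-- **Two steps from an even rank**: `ipSpStep (2m) · ipSpStep (2m+1) = 3^{2m} · a_m` with
`a_m = (3m+2)(6m+3)!(2m+1)!/((4m+2)!(4m+3)!)` the `m`-th factor of `A_V`. [cite: IkhlefPonsaing2012, Prop. 4.7 (proof)] -/
theorem ipSpStep_even_mul_odd (m : ℕ) :
    ipSpStep (2 * m) * ipSpStep (2 * m + 1) =
      (3 : ℚ) ^ (2 * m) *
        (((3 * m + 2 : ℕ) * (6 * m + 3)! * (2 * m + 1)! : ℚ) / ((4 * m + 2)! * (4 * m + 3)! : ℚ)) := by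
  rw [ipSpStep_two_mul, ipSpStep_two_mul_add_one]
  have hQR := prodQ_mul_prodR_cast (2 * m)
  rw [show 3 * (2 * m) + 1 = 6 * m + 1 by ring] at hQR
  set Q := ∏ s ∈ range (2 * m), ((3 * s + 2 : ℚ) * (3 * s + 3)) with hQ
  set R := ∏ s ∈ range (2 * m), ((3 * s + 3 : ℚ) * (3 * s + 4)) with hR
  have f1 : ((6 * m + 3)! : ℚ) = (6 * m + 3 : ℚ) * (6 * m + 2) * ((6 * m + 1)! : ℚ) := by
    rw [show 6 * m + 3 = (6 * m + 2) + 1 by ring, Nat.factorial_succ,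
      show 6 * m + 2 = (6 * m + 1) + 1 by ring, Nat.factorial_succ]
    push_cast
    ring
  have f2 : ((2 * m + 1)! : ℚ) = (2 * m + 1 : ℚ) * ((2 * m)! : ℚ) := by
    rw [Nat.factorial_succ]
    push_cast
    ring
  have f3 : ((4 * m + 2)! : ℚ) = (4 * m + 2 : ℚ) * ((4 * m + 1)! : ℚ) := by
    rw [show 4 * m + 2 = (4 * m + 1) + 1 by ring, Nat.factorial_succ]
    push_cast
    ring
  have f4 : ((4 * m + 1)! : ℚ) ≠ 0 := by positivity
  have f5 : ((4 * m + 3)! : ℚ) ≠ 0 := by positivity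
  have f6 : (4 * m + 2 : ℚ) ≠ 0 := by positivity
  rw [div_mul_div_comm, mul_div_assoc', div_eq_div_iff (by positivity) (by positivity), f1, f2, f3]
  push_cast
  linear_combination
    ((3 * m + 1 : ℚ) * (3 * m + 2) * (6 * m + 3) * ((4 * m + 2 : ℚ) * ((4 * m + 1)! : ℚ) * ((4 * m + 3)! : ℚ))) * hQR

/-- **Two steps from an odd rank**: `ipSpStep (2m+1) · ipSpStep (2m+2) = 3^{2m+1} · n_{m+1}` with
`n_i = (3i+1)(6i)!(2i)!/((4i)!(4i+1)!)` the `i`-th factor of `N_8`. [cite: IkhlefPonsaing2012, Prop. 4.7 (proof)] -/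
theorem ipSpStep_odd_mul_even (m : ℕ) :
    ipSpStep (2 * m + 1) * ipSpStep (2 * m + 2) =
      (3 : ℚ) ^ (2 * m + 1) *
        (((3 * (m + 1) + 1 : ℕ) * (6 * (m + 1))! * (2 * (m + 1))! : ℚ) /
          ((4 * (m + 1))! * (4 * (m + 1) + 1)! : ℚ)) := by
  rw [show 2 * m + 2 = 2 * (m + 1) by ring, ipSpStep_two_mul_add_one, ipSpStep_two_mul]
  have hQR := prodQ_mul_prodR_cast (2 * m)
  rw [show 3 * (2 * m) + 1 = 6 * m + 1 by ring] at hQR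
  have hQ2 : ∏ s ∈ range (2 * (m + 1)), ((3 * s + 2 : ℚ) * (3 * s + 3)) =
      (∏ s ∈ range (2 * m), ((3 * s + 2 : ℚ) * (3 * s + 3))) *
        ((6 * m + 2 : ℚ) * (6 * m + 3) * ((6 * m + 5) * (6 * m + 6))) := by
    rw [show 2 * (m + 1) = 2 * m + 1 + 1 by ring, prod_range_succ, prod_range_succ]
    push_cast
    ring
  rw [hQ2]
  set Q := ∏ s ∈ range (2 * m), ((3 * s + 2 : ℚ) * (3 * s + 3)) with hQ
  set R := ∏ s ∈ range (2 * m), ((3 * s + 3 : ℚ) * (3 * s + 4)) with hR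
  have f1 : ((6 * (m + 1))! : ℚ) =
      (6 * m + 6 : ℚ) * (6 * m + 5) * (6 * m + 4) * (6 * m + 3) * (6 * m + 2) * ((6 * m + 1)! : ℚ) := by
    rw [show 6 * (m + 1) = (6 * m + 5) + 1 by ring, Nat.factorial_succ,
      show 6 * m + 5 = (6 * m + 4) + 1 by ring, Nat.factorial_succ,
      show 6 * m + 4 = (6 * m + 3) + 1 by ring, Nat.factorial_succ,
      show 6 * m + 3 = (6 * m + 2) + 1 by ring, Nat.factorial_succ,
      show 6 * m + 2 = (6 * m + 1) + 1 by ring, Nat.factorial_succ]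
    push_cast
    ring
  have f2 : ((2 * (m + 1))! : ℚ) = (2 * m + 2 : ℚ) * (2 * m + 1) * ((2 * m)! : ℚ) := by
    rw [show 2 * (m + 1) = (2 * m + 1) + 1 by ring, Nat.factorial_succ, Nat.factorial_succ]
    push_cast
    ring
  have f3 : ((4 * (m + 1) + 1)! : ℚ) = (4 * m + 5 : ℚ) * (4 * m + 4) * ((4 * m + 3)! : ℚ) := by
    rw [show 4 * (m + 1) + 1 = (4 * m + 4) + 1 by ring, Nat.factorial_succ,
      show 4 * m + 4 = (4 * m + 3) + 1 by ring, Nat.factorial_succ]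
    push_cast
    ring
  have f3' : ((4 * (m + 1))! : ℚ) = (4 * m + 4 : ℚ) * ((4 * m + 3)! : ℚ) := by
    rw [show 4 * (m + 1) = (4 * m + 3) + 1 by ring, Nat.factorial_succ]
    push_cast
    ring
  have f4 : ((4 * m + 3)! : ℚ) ≠ 0 := by positivity
  rw [div_mul_div_comm, mul_div_assoc', div_eq_div_iff (by positivity) (by positivity), f1, f2, f3, f3']
  push_cast
  linear_combination
    ((3 * m + 2 : ℚ) * (6 * m + 3) * (3 * m + 4) * ((6 * m + 2 : ℚ) * (6 * m + 3) * ((6 * m + 5) * (6 * m + 6))) *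
      ((4 * m + 4 : ℚ) * ((4 * m + 3)! : ℚ) * ((4 * m + 5 : ℚ) * (4 * m + 4) * ((4 * m + 3)! : ℚ)))) * hQR

/-- `D(L+2) = D(L) · step(L) · step(L+1)`. [cite: IkhlefPonsaing2012, Def. 3.4] -/
theorem ipSpDim_add_two (L : ℕ) :
    ipSpDim (L + 2) = ipSpDim L * (ipSpStep L * ipSpStep (L + 1)) := by
  unfold ipSpDim
  rw [prod_range_succ, prod_range_succ, mul_assoc]

/-- **Di Francesco's even evaluation** `χ_{2m}(1,…,1) = 3^{m(m-1)} A_V(2m+1)` (IP12, proof of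
Prop. 4.7, after Di Francesco 2007), for the Weyl-dimension rendering `ipSpDim`.
[cite: IkhlefPonsaing2012, Prop. 4.7 (proof)] -/
theorem ipSpDim_two_mul (m : ℕ) : ipSpDim (2 * m) = (3 : ℚ) ^ (m * (m - 1)) * ipAV m := by
  induction m with
  | zero => simp [ipSpDim, ipAV]
  | succ m ih =>
    have he : (m + 1) * (m + 1 - 1) = m * (m - 1) + 2 * m := by
      rcases m with _ | n
      · rfl
      · simp only [Nat.add_sub_cancel]
        ring
    have hA : ipAV (m + 1) = ipAV m *
        (((3 * m + 2 : ℕ) * (6 * m + 3)! * (2 * m + 1)! : ℚ) / ((4 * m + 2)! * (4 * m + 3)! : ℚ)) := by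
      unfold ipAV
      rw [prod_range_succ]
    rw [show 2 * (m + 1) = 2 * m + 2 by ring, ipSpDim_add_two, ih, ipSpStep_even_mul_odd, hA, he,
      pow_add]
    ring

/-- **Di Francesco's odd evaluation** `χ_{2m+1}(1,…,1) = 3^{m²} N_8(2m+2)` (IP12, proof of
Prop. 4.7: `χ_{2m-1}(1,…,1) = 3^{(m-1)²} N_8(2m)`, after Di Francesco 2007), for the
Weyl-dimension rendering `ipSpDim`. [cite: IkhlefPonsaing2012, Prop. 4.7 (proof)] -/
theorem ipSpDim_two_mul_add_one (m : ℕ) :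
    ipSpDim (2 * m + 1) = (3 : ℚ) ^ (m * m) * ipN8 (m + 1) := by
  induction m with
  | zero =>
    simp [ipSpDim, ipSpStep, ipN8, ipMu]
  | succ m ih =>
    have hN : ipN8 (m + 1 + 1) = ipN8 (m + 1) *
        (((3 * (m + 1) + 1 : ℕ) * (6 * (m + 1))! * (2 * (m + 1))! : ℚ) /
          ((4 * (m + 1))! * (4 * (m + 1) + 1)! : ℚ)) := by
      unfold ipN8
      rw [prod_range_succ]
    rw [show 2 * (m + 1) + 1 = (2 * m + 1) + 2 by ring, ipSpDim_add_two, ih,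
      show 2 * m + 1 + 1 = 2 * m + 2 by ring, ipSpStep_odd_mul_even, hN,
      show (m + 1) * (m + 1) = m * m + (2 * m + 1) by ring, pow_add]
    ring

/-- `ipN8` is positive. [cite: IkhlefPonsaing2012, Prop. 4.7] -/
theorem ipN8_pos (m : ℕ) : 0 < ipN8 m := by
  unfold ipN8
  exact prod_pos fun i _ => by positivity

/-- **The arithmetic of IP12 Prop. 4.7**: `χ_{2m} χ_{2m+2} / χ_{2m+1}² = A_V(2m+1) A_V(2m+3) / N_8(2m+2)²`
(the powers of `3` cancel: `m(m-1) + (m+1)m = 2m²`). [cite: IkhlefPonsaing2012, Prop. 4.7] -/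
theorem ipSpDim_ratio (m : ℕ) :
    ipSpDim (2 * m) * ipSpDim (2 * m + 2) / ipSpDim (2 * m + 1) ^ 2 =
      ipAV m * ipAV (m + 1) / ipN8 (m + 1) ^ 2 := by
  have h3 : (3 : ℚ) ^ (m * (m - 1)) * 3 ^ ((m + 1) * (m + 1 - 1)) = (3 ^ (m * m)) ^ 2 := by
    rw [← pow_add, ← pow_mul]
    congr 1
    rcases m with _ | n
    · rfl
    · simp only [Nat.add_sub_cancel]
      ring
  rw [show 2 * m + 2 = 2 * (m + 1) by ring, ipSpDim_two_mul, ipSpDim_two_mul, ipSpDim_two_mul_add_one,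
    mul_pow, ← h3]
  have hN : ipN8 (m + 1) ≠ 0 := (ipN8_pos _).ne'
  have hp : (3 : ℚ) ^ (m * (m - 1)) ≠ 0 := by positivity
  have hp' : (3 : ℚ) ^ ((m + 1) * (m + 1 - 1)) ≠ 0 := by positivity
  field_simp

/-- The same ratio cast to `ℝ`, with the three products written out literally as in the named fact
`Literature.Probability.Percolation.IkhlefPonsaingFirstPassage`. [cite: IkhlefPonsaing2012, Prop. 4.7] -/
theorem ipSpDim_ratio_real (m : ℕ) :
    ((ipSpDim (2 * m) * ipSpDim (2 * m + 2) / ipSpDim (2 * m + 1) ^ 2 : ℚ) : ℝ) =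
      (∏ i ∈ Finset.range m,
          ((3 * i + 2 : ℕ) * (6 * i + 3).factorial * (2 * i + 1).factorial : ℝ) /
            ((4 * i + 2).factorial * (4 * i + 3).factorial : ℝ)) *
        (∏ i ∈ Finset.range (m + 1),
          ((3 * i + 2 : ℕ) * (6 * i + 3).factorial * (2 * i + 1).factorial : ℝ) /
            ((4 * i + 2).factorial * (4 * i + 3).factorial : ℝ)) /
      (∏ i ∈ Finset.range (m + 1),
          ((3 * i + 1 : ℕ) * (6 * i).factorial * (2 * i).factorial : ℝ) /
            ((4 * i).factorial * (4 * i + 1).factorial : ℝ)) ^ 2 := by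
  rw [ipSpDim_ratio]
  unfold ipAV ipN8
  push_cast
  rfl

end Literature.Combinatorics.Enumerative
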